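import Summits.CriticalPhenomena.PercolationContinuityZ3.Theorems.PercNearOneGluingNoHeavyLowerTailSahiBlocksAllButOneReal

/-!
# `NoHeavyLowerTail` (crux stmt-CriticalPhenomena-4575), Sahi / Kahn positivity: ALL BLOCKS BUT ONE (III) — extreme decomposition, the block inequality, row (o)

Support file (cell `prim-l12`, seat P3, gen 8; `--supports stmt-CriticalPhenomena-4575`).  No `sorry`, no named facts, standard axioms.
New mathematics (this programme).

Continuation of `…SahiBlocksAllButOneReal` (transport polynomial `Npoly` of a block configuration; affine in each block's
`(a_j, b_j, a_jb_j, c_j)` with nonnegative `c_j`-coefficient; nonnegative on extreme configurations).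
* `exists_decomp`: every admissible block state `(a,b,c)` (`0 ≤ a,b ≤ r`, `c ≥ 0`, `(1+a)(1+b) ≤ (1+c)(1+r)`) has the same `a, b, ab` as, and a
  larger `c` than, an explicit convex combination of three EXTREME states — high case `(1+a)(1+b) ≥ 1+r`: the hyperbola point `(a,(r−a)/(1+a))`,
  `(0,r)`, `(r,r,r)` with weights `λ, (1−λ)μ, (1−λ)(1−μ)`, `λ = (r−b)(1+a)/((1+r)a)`, `μ = (r−a)/r` (mean of `c` = `(1+a)(1+b)/(1+r) − 1`);
  low case: `(0,0,0)`, `(r,0)`, hyperbola point, weights `λμ, λ(1−μ), 1−λ`, `λ = (1+r−(1+a)(1+b))/(r−a)` (mean of `c` = `0`);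
* `Npoly_nonneg`: **the transport row for all blocks but one holds for every number of blocks, all odds and all admissible states**
  (induction on the set of non-extreme blocks: lower `c_j` to the mean, split into the three extreme states, recurse);
* `blocks_o_real`: the domination row `σ(∏(1+τ_i) − 1 − Στ) ≤ (Π − 1 − σ)Στ` for `0 ≤ τ_i ≤ r_i` (induction on the set of blocks; the step is
  affine in `τ_j` and is checked at `τ_j ∈ {0, r_j}` via `T' − 1 ≤ Π's'` and `T'(1+σ') ≤ Π'(1+s')`). [this work]
-/

noncomputable section

open scoped Classical

namespace Summit.CriticalPhenomena.PercolationContinuityZ3.Theorems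

namespace SahiBlocksAllButOne

open Finset Function
open SahiAllButOne (one_add_sum_le_prod_one_add prod_one_add_mul_one_sub_sum_le_one)

variable {m : ℕ}

/-! ### One block: the convex decomposition into extreme states -/

/-- **Extreme decomposition of an admissible block state.**  Weights `l₁,l₂,l₃` and extreme states with the same means of `a, b, ab` and a
smaller mean of `c` (two rulings of the saddle `ab`; high case `(1+a)(1+b) ≥ 1+r` through the hyperbola point `(a, (r−a)/(1+a))`, `(0,r)`,
`(r,r)`; low case through `(0,0)`, `(r,0)` and the hyperbola point). [this work] -/
theorem exists_decomp {ρ α β γ : ℝ} (hρ : 0 ≤ ρ) (h : Adm ρ α β γ) :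
    ∃ l1 l2 l3 α1 β1 γ1 α2 β2 γ2 α3 β3 γ3 : ℝ, 0 ≤ l1 ∧ 0 ≤ l2 ∧ 0 ≤ l3 ∧ l1 + l2 + l3 = 1 ∧
      (IsExt ρ α1 β1 γ1 ∧ 0 ≤ α1 ∧ 0 ≤ β1) ∧ (IsExt ρ α2 β2 γ2 ∧ 0 ≤ α2 ∧ 0 ≤ β2) ∧ (IsExt ρ α3 β3 γ3 ∧ 0 ≤ α3 ∧ 0 ≤ β3) ∧
      l1 * α1 + l2 * α2 + l3 * α3 = α ∧ l1 * β1 + l2 * β2 + l3 * β3 = β ∧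
      l1 * (α1 * β1) + l2 * (α2 * β2) + l3 * (α3 * β3) = α * β ∧ l1 * γ1 + l2 * γ2 + l3 * γ3 ≤ γ := by
  obtain ⟨hα, hαρ, hβ, hβρ, hγ, hH⟩ := h
  have ext00 : IsExt ρ 0 0 0 := Or.inl ⟨rfl, rfl, rfl⟩
  have extrr : IsExt ρ ρ ρ ρ := Or.inr (Or.inl ⟨rfl, rfl, rfl⟩)
  have ext0r : IsExt ρ 0 ρ 0 := Or.inr (Or.inr ⟨by ring, rfl⟩)
  have extr0 : IsExt ρ ρ 0 0 := Or.inr (Or.inr ⟨by ring, rfl⟩)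
  -- degenerate odds: the state is the corner `(0,0,·)`
  rcases eq_or_lt_of_le hρ with hρ0 | hρpos
  · have hα0 : α = 0 := le_antisymm (hρ0 ▸ hαρ) hα
    have hβ0 : β = 0 := le_antisymm (hρ0 ▸ hβρ) hβ
    refine ⟨1, 0, 0, 0, 0, 0, 0, 0, 0, 0, 0, 0, zero_le_one, le_rfl, le_rfl, by ring, ⟨ext00, le_rfl, le_rfl⟩, ⟨ext00, le_rfl, le_rfl⟩,
      ⟨ext00, le_rfl, le_rfl⟩, ?_, ?_, ?_, ?_⟩
    · rw [hα0]; ring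
    · rw [hβ0]; ring
    · rw [hα0]; ring
    · linarith
  by_cases hhigh : 1 + ρ ≤ (1 + α) * (1 + β)
  · -- HIGH CASE `(1+a)(1+b) ≥ 1+r`
    rcases eq_or_lt_of_le hα with hα0 | hαpos
    · -- `a = 0` forces `b = r`: the state is the hyperbola corner `(0, r, 0)`
      have hb : β = ρ := by apply le_antisymm hβρ; rw [← hα0] at hhigh; nlinarith
      refine ⟨1, 0, 0, 0, ρ, 0, 0, 0, 0, 0, 0, 0, zero_le_one, le_rfl, le_rfl, by ring, ⟨ext0r, le_rfl, hρ⟩, ⟨ext00, le_rfl, le_rfl⟩,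
        ⟨ext00, le_rfl, le_rfl⟩, ?_, ?_, ?_, ?_⟩
      · rw [← hα0]; ring
      · rw [hb]; ring
      · rw [← hα0]; ring
      · linarith
    · set lam := (ρ - β) * (1 + α) / ((1 + ρ) * α) with hlam
      set mu := (ρ - α) / ρ with hmu
      set b1 := (ρ - α) / (1 + α) with hb1
      have hden : 0 < (1 + ρ) * α := mul_pos (by linarith) hαpos
      have hlam0 : 0 ≤ lam := div_nonneg (mul_nonneg (by linarith) (by linarith)) hden.le
      have hlam1 : lam ≤ 1 := by rw [hlam, div_le_one hden]; nlinarith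
      have hmu0 : 0 ≤ mu := div_nonneg (by linarith) hρpos.le
      have hmu1 : mu ≤ 1 := by rw [hmu, div_le_one hρpos]; linarith
      have hb10 : 0 ≤ b1 := div_nonneg (by linarith) (by linarith)
      have h1α : (1 + α) ≠ 0 := by positivity
      have hcurve : (1 + α) * (1 + b1) = 1 + ρ := by rw [hb1]; field_simp; ring
      refine ⟨lam, (1 - lam) * mu, (1 - lam) * (1 - mu), α, b1, 0, 0, ρ, 0, ρ, ρ, ρ, hlam0, mul_nonneg (by linarith) hmu0,
        mul_nonneg (by linarith) (by linarith), by ring, ⟨Or.inr (Or.inr ⟨hcurve, rfl⟩), hα, hb10⟩, ⟨ext0r, le_rfl, hρ⟩,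
        ⟨extrr, hρ, hρ⟩, ?_, ?_, ?_, ?_⟩
      · rw [hlam, hmu]; field_simp; ring
      · rw [hlam, hmu, hb1]; field_simp; ring
      · rw [hlam, hmu, hb1]; field_simp; ring
      · -- the mean of `c` is `(1+a)(1+b)/(1+r) − 1 ≤ c`
        have hmean : lam * 0 + (1 - lam) * mu * 0 + (1 - lam) * (1 - mu) * ρ = ((1 + α) * (1 + β) - (1 + ρ)) / (1 + ρ) := by
          rw [hlam, hmu]; field_simp; ring
        rw [hmean, div_le_iff₀ (by linarith : (0:ℝ) < 1 + ρ)]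
        nlinarith
  · -- LOW CASE `(1+a)(1+b) ≤ 1+r`
    push Not at hhigh
    rcases eq_or_lt_of_le hαρ with hαr | hαlt
    · -- `a = r` forces `b = 0`: the state is the hyperbola corner `(r, 0, 0)`
      have hb : β = 0 := by apply le_antisymm _ hβ; rw [hαr] at hhigh; nlinarith
      refine ⟨1, 0, 0, ρ, 0, 0, 0, 0, 0, 0, 0, 0, zero_le_one, le_rfl, le_rfl, by ring, ⟨extr0, hρ, le_rfl⟩, ⟨ext00, le_rfl, le_rfl⟩,
        ⟨ext00, le_rfl, le_rfl⟩, ?_, ?_, ?_, ?_⟩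
      · rw [hαr]; ring
      · rw [hb]; ring
      · rw [hb]; ring
      · linarith
    · set lam := (1 + ρ - (1 + α) * (1 + β)) / (ρ - α) with hlam
      set mu := (ρ - α) / ρ with hmu
      set b3 := (ρ - α) / (1 + α) with hb3
      have hden : 0 < ρ - α := by linarith
      have hlam0 : 0 ≤ lam := div_nonneg (by linarith) hden.le
      have hlam1 : lam ≤ 1 := by rw [hlam, div_le_one hden]; nlinarith
      have hmu0 : 0 ≤ mu := div_nonneg (by linarith) hρpos.le
      have hmu1 : mu ≤ 1 := by rw [hmu, div_le_one hρpos]; linarith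
      have hb30 : 0 ≤ b3 := div_nonneg (by linarith) (by linarith)
      have h1α : (1 + α) ≠ 0 := by positivity
      have hcurve : (1 + α) * (1 + b3) = 1 + ρ := by rw [hb3]; field_simp; ring
      refine ⟨lam * mu, lam * (1 - mu), 1 - lam, 0, 0, 0, ρ, 0, 0, α, b3, 0, mul_nonneg hlam0 hmu0, mul_nonneg hlam0 (by linarith),
        by linarith, by ring, ⟨ext00, le_rfl, le_rfl⟩, ⟨extr0, hρ, le_rfl⟩, ⟨Or.inr (Or.inr ⟨hcurve, rfl⟩), hα, hb30⟩, ?_, ?_, ?_, ?_⟩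
      · rw [hlam, hmu]; field_simp; ring
      · rw [hlam, hb3]; field_simp; ring
      · rw [hlam, hb3]; field_simp; ring
      · linarith

/-! ### The block inequality -/

/-- Induction on the set of blocks that are not yet extreme. [this work] -/
theorem Npoly_nonneg_aux (r : Fin m → ℝ) (hr : ∀ i, 0 ≤ r i) (S : Finset (Fin m)) :
    ∀ a b c : Fin m → ℝ, (∀ i, Adm (r i) (a i) (b i) (c i)) → (∀ i, i ∉ S → IsExt (r i) (a i) (b i) (c i)) →
      0 ≤ Npoly r a b c := by
  induction S using Finset.induction_on with
  | empty =>
    intro a b c hadm hext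
    exact Npoly_nonneg_of_ext r a b c hr (fun i => (hadm i).1) (fun i => (hadm i).2.2.1) fun i => hext i (notMem_empty i)
  | insert j S hj ih =>
    intro a b c hadm hext
    obtain ⟨l1, l2, l3, α1, β1, γ1, α2, β2, γ2, α3, β3, γ3, hl1, hl2, hl3, hl, hs1, hs2, hs3, hα, hβ, hαβ, hγ⟩ :=
      exists_decomp (hr j) (hadm j)
    -- lower `c_j` to the mean, then split into the three extreme states
    have hmono := Npoly_mono_c r a b c hr j hγ
    rw [update_eq_self] at hmono
    refine le_trans ?_ hmono
    have hconv := Npoly_convex r a b c j l1 l2 l3 α1 β1 γ1 α2 β2 γ2 α3 β3 γ3 (a j) (b j) (l1 * γ1 + l2 * γ2 + l3 * γ3) hl hα hβ hαβ rfl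
    rw [update_eq_self, update_eq_self] at hconv
    rw [← hconv]
    -- the induction hypothesis applies to each extreme update
    have hih : ∀ α' β' γ', IsExt (r j) α' β' γ' → 0 ≤ α' → 0 ≤ β' →
        0 ≤ Npoly r (update a j α') (update b j β') (update c j γ') := by
      intro α' β' γ' he hα' hβ'
      refine ih _ _ _ (fun i => ?_) (fun i hi => ?_)
      · by_cases hij : i = j
        · subst hij; rw [update_self, update_self, update_self]; exact adm_of_isExt (hr i) hα' hβ' he
        · rw [update_of_ne hij, update_of_ne hij, update_of_ne hij]; exact hadm i
      · by_cases hij : i = j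
        · subst hij; rw [update_self, update_self, update_self]; exact he
        · rw [update_of_ne hij, update_of_ne hij, update_of_ne hij]
          exact hext i fun h => (mem_insert.1 h).elim hij hi
    exact add_nonneg (add_nonneg (mul_nonneg hl1 (hih _ _ _ hs1.1 hs1.2.1 hs1.2.2)) (mul_nonneg hl2 (hih _ _ _ hs2.1 hs2.2.1 hs2.2.2)))
      (mul_nonneg hl3 (hih _ _ _ hs3.1 hs3.2.1 hs3.2.2))

/-- **THE REAL BLOCK INEQUALITY (TC) FOR ALL BLOCKS BUT ONE.**  For every number of blocks, all odds `r_i ≥ 0` and all admissible block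
states: `Npoly r a b c ≥ 0`. [this work] -/
theorem Npoly_nonneg (r a b c : Fin m → ℝ) (hr : ∀ i, 0 ≤ r i) (hadm : ∀ i, Adm (r i) (a i) (b i) (c i)) : 0 ≤ Npoly r a b c :=
  Npoly_nonneg_aux r hr univ a b c hadm fun i hi => (hi (mem_univ i)).elim

/-! ### The domination row (o) in real form -/

/-- **(o) for all blocks but one**: `σ_s(∏_s(1+τ) − 1 − Σ_sτ) ≤ (Π_s − 1 − σ_s)·Σ_sτ` for `0 ≤ τ_i ≤ r_i`, by induction on the set of blocks.
[this work] -/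
theorem blocks_o_real (r τ : Fin m → ℝ) (hr : ∀ i, 0 ≤ r i) (hτ : ∀ i, 0 ≤ τ i ∧ τ i ≤ r i) (s : Finset (Fin m)) :
    (∑ i ∈ s, r i) * ((∏ i ∈ s, (1 + τ i)) - 1 - ∑ i ∈ s, τ i) ≤ ((∏ i ∈ s, (1 + r i)) - 1 - ∑ i ∈ s, r i) * ∑ i ∈ s, τ i := by
  induction s using Finset.induction_on with
  | empty => simp
  | insert j s hj ih =>
    rw [sum_insert hj, sum_insert hj, prod_insert hj, prod_insert hj]
    set σ' := ∑ i ∈ s, r i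
    set s' := ∑ i ∈ s, τ i
    set Pp := ∏ i ∈ s, (1 + r i)
    set T' := ∏ i ∈ s, (1 + τ i)
    obtain ⟨ht0, htr⟩ := hτ j
    have hρ := hr j
    have hs'0 : 0 ≤ s' := sum_nonneg fun i _ => (hτ i).1
    have hσ's' : s' ≤ σ' := sum_le_sum fun i _ => (hτ i).2
    have hT'1 : 1 + s' ≤ T' := one_add_sum_le_prod_one_add s τ fun i _ => (hτ i).1
    have hT'Pp : T' ≤ Pp := prod_le_prod (fun i _ => by linarith [(hτ i).1]) fun i _ => by linarith [(hτ i).2]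
    have hTs : T' * (1 - s') ≤ 1 := prod_one_add_mul_one_sub_sum_le_one s τ fun i _ => (hτ i).1
    -- (i) `T' − 1 ≤ Pp s'`
    have h1 : T' - 1 ≤ Pp * s' := by nlinarith
    -- (ii) `Pp(1+s') ≥ T'(1+σ')`: `Pp/T' = ∏(1+δ_i) ≥ 1 + Σδ_i ≥ 1 + (σ'−s')/(1+s')`
    have h2 : T' * (1 + σ') ≤ Pp * (1 + s') := by
      have key : ∀ u : Finset (Fin m), (∏ i ∈ u, (1 + τ i)) * (1 + ∑ i ∈ u, τ i + ∑ i ∈ u, (r i - τ i)) ≤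
          (∏ i ∈ u, (1 + r i)) * (1 + ∑ i ∈ u, τ i) := by
        intro u
        induction u using Finset.induction_on with
        | empty => simp
        | insert k u hk ihu =>
          rw [prod_insert hk, prod_insert hk, sum_insert hk, sum_insert hk]
          set Tu := ∏ i ∈ u, (1 + τ i)
          set Pu := ∏ i ∈ u, (1 + r i)
          set su := ∑ i ∈ u, τ i
          set du := ∑ i ∈ u, (r i - τ i)
          obtain ⟨hk0, hkr⟩ := hτ k
          have hTu : 0 ≤ Tu := prod_nonneg fun i _ => by linarith [(hτ i).1]
          have hsu : 0 ≤ su := sum_nonneg fun i _ => (hτ i).1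
          have hdu : 0 ≤ du := sum_nonneg fun i _ => by linarith [(hτ i).2]
          have hTu1 : 1 + su ≤ Tu := one_add_sum_le_prod_one_add u τ fun i _ => (hτ i).1
          -- `(1+τ_k)Tu(1 + τ_k + su + (r_k − τ_k) + du) ≤ (1+r_k) Pu (1 + τ_k + su)`
          have hPT : Tu ≤ Pu := prod_le_prod (fun i _ => by linarith [(hτ i).1]) fun i _ => by linarith [(hτ i).2]
          have f1 : (1 + r k) * (Tu * (1 + su + du)) ≤ (1 + r k) * (Pu * (1 + su)) := mul_le_mul_of_nonneg_left ihu (by linarith)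
          have f2 : (1 + r k) * τ k * Tu ≤ (1 + r k) * τ k * Pu := mul_le_mul_of_nonneg_left hPT (mul_nonneg (by linarith) hk0)
          have f3 : 0 ≤ (r k - τ k) * (Tu * (su + du)) := mul_nonneg (sub_nonneg.2 hkr) (mul_nonneg hTu (add_nonneg hsu hdu))
          nlinarith [f1, f2, f3]
      have hsum : ∑ i ∈ s, (r i - τ i) = σ' - s' := by rw [sum_sub_distrib]
      have := key s
      rw [hsum] at this
      nlinarith
    -- (iii) the claim is affine in `t = τ_j ∈ [0, r_j]`; check the endpoints
    have hIH : 0 ≤ (Pp - 1 - σ') * s' - σ' * (T' - 1 - s') := by linarith [ih]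
    have hE0 : 0 ≤ Pp * s' - T' + 1 := by linarith [h1]
    have hEρ : 0 ≤ (Pp * (1 + s') - T' * (1 + σ')) + r j * (Pp - T') := add_nonneg (by linarith [h2]) (mul_nonneg hρ (by linarith))
    have hid : ((1 + r j) * Pp - 1 - (r j + σ')) * (τ j + s') - (r j + σ') * ((1 + τ j) * T' - 1 - (τ j + s'))
        = ((Pp - 1 - σ') * s' - σ' * (T' - 1 - s')) + (r j * (Pp * s' - T' + 1) + τ j * (Pp - 1 - σ' * T' + r j * (Pp - T'))) := by
      ring
    have hextra : 0 ≤ r j * (Pp * s' - T' + 1) + τ j * (Pp - 1 - σ' * T' + r j * (Pp - T')) := by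
      rcases eq_or_lt_of_le hρ with hρ0 | hρpos
      · have ht : τ j = 0 := le_antisymm (hρ0 ▸ htr) ht0
        rw [ht, ← hρ0]; simp
      · have hid2 : r j * (r j * (Pp * s' - T' + 1) + τ j * (Pp - 1 - σ' * T' + r j * (Pp - T'))) =
            (r j - τ j) * (r j * (Pp * s' - T' + 1)) + τ j * (r j * ((Pp * (1 + s') - T' * (1 + σ')) + r j * (Pp - T'))) := by ring
        have hprod : 0 ≤ r j * (r j * (Pp * s' - T' + 1) + τ j * (Pp - 1 - σ' * T' + r j * (Pp - T'))) := by
          rw [hid2]; exact add_nonneg (mul_nonneg (sub_nonneg.2 htr) (mul_nonneg hρ hE0)) (mul_nonneg ht0 (mul_nonneg hρ hEρ))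
        exact (mul_nonneg_iff_of_pos_left hρpos).1 hprod
    rw [← sub_nonneg, hid]
    exact add_nonneg hIH hextra


/-! ### `W`-forms (as produced by the probability side: `W = μ(all blocks open) = 1/Π`) -/

/-- `Π = ∏(1+r_i) > 0`. [this work] -/
theorem bprod_pos (r : Fin m → ℝ) (hr : ∀ i, 0 ≤ r i) : 0 < bprod r :=
  prod_pos fun i _ => by linarith [hr i]

/-- **The transport row (TC) in `W`-form.** [this work] -/
theorem blocks_tc_W (r a b c : Fin m → ℝ) (hr : ∀ i, 0 ≤ r i) (hadm : ∀ i, Adm (r i) (a i) (b i) (c i)) (hσ : 0 < bsum r)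
    (W : ℝ) (hW : W * bprod r = 1) :
    W * (1 + bsum r) * (1 - W * (1 + bsum r)) * (W * bsum c / (W * bsum r)) ≤
      (2 - W * (1 + bsum r)) * (W * (1 + bsum c)) + W * (1 + bsum r) * ((W * bprod a) * (W * bprod b))
        - (W * bprod a) * (W * (1 + bsum b)) - (W * bprod b) * (W * (1 + bsum a)) := by
  have hN := Npoly_nonneg r a b c hr hadm
  rw [Npoly] at hN
  have hP := bprod_pos r hr
  have hWeq : W = 1 / bprod r := by rw [eq_div_iff hP.ne']; exact hW
  subst hWeq
  have hσne : bsum r ≠ 0 := hσ.ne'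
  have hPne : bprod r ≠ 0 := hP.ne'
  rw [← sub_nonneg]
  have hid : (2 - 1 / bprod r * (1 + bsum r)) * (1 / bprod r * (1 + bsum c))
        + 1 / bprod r * (1 + bsum r) * ((1 / bprod r * bprod a) * (1 / bprod r * bprod b))
        - (1 / bprod r * bprod a) * (1 / bprod r * (1 + bsum b)) - (1 / bprod r * bprod b) * (1 / bprod r * (1 + bsum a))
        - 1 / bprod r * (1 + bsum r) * (1 - 1 / bprod r * (1 + bsum r)) * (1 / bprod r * bsum c / (1 / bprod r * bsum r)) =
      (bsum r * ((2 * bprod r - 1 - bsum r) * (1 + bsum c) * bprod r + (1 + bsum r) * (bprod a * bprod b)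
          - bprod r * bprod a * (1 + bsum b) - bprod r * bprod b * (1 + bsum a))
        - (1 + bsum r) * (bprod r - 1 - bsum r) * bsum c * bprod r) / (bsum r * bprod r ^ 3) := by
    field_simp
    ring
  rw [hid]
  exact div_nonneg hN (by positivity)

/-- **The domination row (o) in `W`-form.** [this work] -/
theorem blocks_o_W (r τ : Fin m → ℝ) (hr : ∀ i, 0 ≤ r i) (hτ : ∀ i, 0 ≤ τ i ∧ τ i ≤ r i) (hσ : 0 < bsum r)
    (W : ℝ) (hW : W * bprod r = 1) :
    W * bprod τ - W * (1 + bsum τ) ≤ (1 - W * (1 + bsum r)) * (W * bsum τ / (W * bsum r)) := by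
  have ho := blocks_o_real r τ hr hτ univ
  have hP := bprod_pos r hr
  have hWeq : W = 1 / bprod r := by rw [eq_div_iff hP.ne']; exact hW
  subst hWeq
  have hσne : bsum r ≠ 0 := hσ.ne'
  have hPne : bprod r ≠ 0 := hP.ne'
  rw [← sub_nonneg]
  have hid : (1 - 1 / bprod r * (1 + bsum r)) * (1 / bprod r * bsum τ / (1 / bprod r * bsum r)) - (1 / bprod r * bprod τ - 1 / bprod r * (1 + bsum τ)) =
      (((bprod r) - 1 - bsum r) * bsum τ - bsum r * (bprod τ - 1 - bsum τ)) / (bsum r * bprod r) := by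
    field_simp
    ring
  rw [hid]
  refine div_nonneg ?_ (by positivity)
  rw [bsum, bsum, bprod, bprod]
  linarith [ho]

end SahiBlocksAllButOne

end Summit.CriticalPhenomena.PercolationContinuityZ3.Theorems
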